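import Summits.QuantumFields.YangMills.Theorems.FluctuationComparisonRegPrIntLS1aFibreOpenMember
import HarnessLib

/-!
# Route `UnitScaleTilt`, crux K1b-INT `FluctuationComparisonRegPrIntL` (stmt-QuantumFields-20520) — S1aᴴ `RunClassMembershipH`, conjuncts (a)∕(c):
# CENTRAL-EDGE PLAQUETTES: THE PLAQUETTE VARIABLE IS OPEN ALONG THE FIBRES OF BAŁABAN'S (0.4) AVERAGING AT SMALL FIELDS —
# (T⊥)(iii) of UV3-NODE §67.7–§67.9 for the private-reading plaquettes (`SU(2)`, chart-free)

Cell `ym3-torus` (rung R3: SU(2) YM₃ on T³ — NOT d = 4, NOT infinite volume, NOT a mass gap, NOT Clay), width seat `ym3-torus-px13` g24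
(`--supports stmt-QuantumFields-20520`, def-free).  FILE 5 of the centre-leg series (✓p820456, ✓p820802, ✓p821306, ✓p821341, ✓p821887
`…S1aFibreOpenMember`); UV3-NODE §78.  The member-loop twin is ✓`loopHol_fibre_locally_onto`; this file treats the OTHER private-reading
targets of §78.1: the fine plaquettes one of whose edges is a central crossing bond `β(c₀)` (`2(d−1)` per coarse bond).
THE CONSTRUCTION ([folklore]; every analytic input is a landed theorem).  Given `x` near `U(∂p)`: (1) DRIVER — move the edge `β(c₀)` of `p`:
`U(∂p)` reads its four (pairwise distinct, `plaq_edges_ne`) edges once each, so one edge move realises every target — `x = g·U(∂p)` for the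
first edge, a conjugate ∕ inverse-conjugate for the others (`exists_edge_driver`, with `dist1 g = dist1 (x·U(∂p)⁻¹)`); among the averages
only `Ū(c₀)` moves (FACT (A)); (2) CENTRE LEG — restore `Ū(c₀)` by `⟨emb c₀₋, ν⟩` (✓`centreLeg_surjective` at the moved background; the centre leg
is not an edge of `p` — hypothesis `hleg` — and not private, ✓`centreLeg_ne_centralBond`); (3) PRIVATE BONDS — restore every other `Ū(c″)` by
`β(c″)` (✓`OneStepSubmersion.fibrewise_avgFun`); no `β(c″)`, `c″ ≠ c₀`, is an edge of `p` — hypothesis `hfree` — so the plaquette keeps the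
driven value.  The two lattice side conditions `hfree`∕`hleg` hold for every plaquette through a central crossing bond when `L ≥ 3` (residues
`L−1`, `(L−1)∕2`, `(L+1)∕2`, `0` mod `L` are distinct); they are DISPLAYED here, their proof is left to a successor file.
WHAT THIS FILE PROVES (`Params` arbitrary in the standing range): §1 `plaqHol_congr_edges`, `shift_ne_self`, `plaq_edges_ne`,
★`exists_edge_driver` (any group); §2 ★★★`plaqHol_fibre_locally_onto` — for `U` `δ₁`-small (`((d+2)L)²δ₁∕4 < δ₂`) with loop variables at `c₀`
within `α` (`α < 1∕24`, `α < δ₂∕2`, `800ℓα < κ`, `κ = s′∕|I|`, `ν ≠ c₀.dir`), a plaquette `p` with `β(c₀) ∈ ∂p`, `hfree`, `hleg`, every `ε > 0`: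
**`∃ η > 0, ∀ x, dist1 (x·U(∂p)⁻¹) < η → ∃ U′, (∀ b, ‖U′(b) − U(b)‖ < ε) ∧ Ū(U′) = Ū(U) ∧ U′(∂p) = x`** (`Ū = avgFun expMeanLogSU`).
One decl-local `maxHeartbeats 400000` on the main theorem (README heartbeat rule).
HONEST SCOPE.  Bookkeeping over landed theorems; nothing of Bałaban's beyond ✓`norm_avgFun_ratio_sub_one_sub_covLinAvg_le`; the two lattice side
conditions are hypotheses; (T⊥)'s consumers (S1aᴴ (a)∕(c) suppliers, (C-an), (C-size)), S1aᴴ, the five registered stubs, crux 20520 and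
`YM3TorusSU2` are NOT proved; the Yang–Mills mass gap is NOT proved.
-/

set_option autoImplicit false

noncomputable section

open scoped Matrix.Norms.L2Operator Topology
open Filter Function

namespace Summit.QuantumFields.YangMills.Theorems.FluctuationComparisonRegPrIntLS1aFibreOpenPlaquette

open Literature.MathematicalPhysics.QuantumFieldTheory.Balaban1983to89
open T4Continuum AveragingRT BlockAveraging ExpMeanLog BlockAveragingHaarAC
open Summit.QuantumFields.YangMills.Theorems.FluctuationComparisonRegPrIntLS1aCentreLegOccurrence
open Summit.QuantumFields.YangMills.Theorems.FluctuationComparisonRegPrIntLS1aCentreLegResponse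
open Summit.QuantumFields.YangMills.Theorems.FluctuationComparisonRegPrIntLS1aCentreLegSurjective
open Summit.QuantumFields.YangMills.Theorems.FluctuationComparisonRegPrIntLS1aFibreOpenMember

/-! ## §1 The plaquette variable under a move of ONE of its edges -/

section Edges

variable {P : Params} {j : ℕ} {G : Type*} [GaugeGroup G] [DecidableEq (PBond P j)]

omit [DecidableEq (PBond P j)] in
/-- The plaquette variable reads only its four edges. [cite: Balaban1985Averaging, (9) p.19] -/
theorem plaqHol_congr_edges {U U' : GaugeField P j G} (p : Plaq P j)
    (h1 : U ⟨p.src, p.μ⟩ = U' ⟨p.src, p.μ⟩) (h2 : U ⟨p.src.shift p.μ, p.ν⟩ = U' ⟨p.src.shift p.μ, p.ν⟩)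
    (h3 : U ⟨p.src.shift p.ν, p.μ⟩ = U' ⟨p.src.shift p.ν, p.μ⟩) (h4 : U ⟨p.src, p.ν⟩ = U' ⟨p.src, p.ν⟩) :
    GaugeField.plaqHol U p = GaugeField.plaqHol U' p := by
  unfold GaugeField.plaqHol; rw [h1, h2, h3, h4]

omit [DecidableEq (PBond P j)] in
/-- A unit step changes the site (standing range: the period is `≥ 2L > 1`). [folklore] -/
theorem shift_ne_self (hj : j + 1 ≤ P.m + P.K) (x : Site P j) (κ : Fin P.d) : x.shift κ ≠ x := by
  intro h
  have h1 := congrFun h κ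
  rw [Site.shift_apply, if_pos rfl] at h1
  have h2 : (1 : ZMod (P.sitesPerDir j)) = 0 := add_eq_left.mp h1
  have hN := AveragingReflection.two_mul_L_le_sitesPerDir hj
  have hL := P.L_pos
  have : Fact (1 < P.sitesPerDir j) := ⟨by omega⟩
  exact one_ne_zero h2

omit [DecidableEq (PBond P j)] in
/-- The four edges of a plaquette are pairwise distinct (the two `μ`-edges differ by `e_ν`, the two `ν`-edges by `e_μ`, and `μ < ν`).
[folklore] -/
theorem plaq_edges_ne (hj : j + 1 ≤ P.m + P.K) (p : Plaq P j) :
    (⟨p.src, p.μ⟩ : PBond P j) ≠ ⟨p.src.shift p.μ, p.ν⟩ ∧ (⟨p.src, p.μ⟩ : PBond P j) ≠ ⟨p.src.shift p.ν, p.μ⟩ ∧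
      (⟨p.src, p.μ⟩ : PBond P j) ≠ ⟨p.src, p.ν⟩ ∧ (⟨p.src.shift p.μ, p.ν⟩ : PBond P j) ≠ ⟨p.src.shift p.ν, p.μ⟩ ∧
      (⟨p.src.shift p.μ, p.ν⟩ : PBond P j) ≠ ⟨p.src, p.ν⟩ ∧ (⟨p.src.shift p.ν, p.μ⟩ : PBond P j) ≠ ⟨p.src, p.ν⟩ := by
  have hμν : p.μ ≠ p.ν := ne_of_lt p.hμν
  refine ⟨fun h => hμν (PBond.mk.injEq _ _ _ _ ▸ h :).2, fun h => (shift_ne_self hj p.src p.ν) ((PBond.mk.injEq _ _ _ _ ▸ h :).1).symm,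
    fun h => hμν (PBond.mk.injEq _ _ _ _ ▸ h :).2, fun h => hμν.symm (PBond.mk.injEq _ _ _ _ ▸ h :).2,
    fun h => (shift_ne_self hj p.src p.μ) ((PBond.mk.injEq _ _ _ _ ▸ h :).1), fun h => hμν (PBond.mk.injEq _ _ _ _ ▸ h :).2⟩

/-- **THE EDGE DRIVER.**  If `e` is one of the four edges of `p`, then for every target `x` there is `g` with `dist1 g = dist1 (x · U(∂p)⁻¹)`
such that moving `U(e) ↦ g·U(e)` turns `U(∂p)` into `x` (edge 1: `x = g·U(∂p)`; edge 2: conjugate by `U(e₁)`; edges 3, 4: the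
inverse, conjugated). [folklore] -/
theorem exists_edge_driver (hj : j + 1 ≤ P.m + P.K) (U : GaugeField P j G) (p : Plaq P j) {e : PBond P j}
    (he : e = ⟨p.src, p.μ⟩ ∨ e = ⟨p.src.shift p.μ, p.ν⟩ ∨ e = ⟨p.src.shift p.ν, p.μ⟩ ∨ e = ⟨p.src, p.ν⟩) (x : G) :
    ∃ g : G, dist1 g = dist1 (x * (GaugeField.plaqHol U p)⁻¹) ∧ GaugeField.plaqHol (update U e (g * U e)) p = x := by
  obtain ⟨h12, h13, h14, h23, h24, h34⟩ := plaq_edges_ne hj p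
  rcases he with rfl | rfl | rfl | rfl
  · -- edge 1: `x = g · U(∂p)`
    refine ⟨x * (GaugeField.plaqHol U p)⁻¹, rfl, ?_⟩
    unfold GaugeField.plaqHol
    rw [update_self, update_of_ne h12.symm, update_of_ne h13.symm, update_of_ne h14.symm]
    group
  · -- edge 2: conjugate by `U(e₁)`
    refine ⟨(U ⟨p.src, p.μ⟩)⁻¹ * (x * (GaugeField.plaqHol U p)⁻¹) * U ⟨p.src, p.μ⟩, ?_, ?_⟩
    · conv_lhs => rw [show (U ⟨p.src, p.μ⟩ : G) = ((U ⟨p.src, p.μ⟩)⁻¹)⁻¹ from (inv_inv _).symm]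
      rw [inv_inv, GaugeGroup.dist1_conj]
    · unfold GaugeField.plaqHol
      rw [update_self, update_of_ne h12, update_of_ne h23.symm, update_of_ne h24.symm]
      group
  · -- edge 3 (inverted in `U(∂p)`): `g = U(e₄)⁻¹ · (x⁻¹·U(∂p)) · U(e₄)`
    refine ⟨(U ⟨p.src, p.ν⟩)⁻¹ * (x⁻¹ * GaugeField.plaqHol U p) * U ⟨p.src, p.ν⟩, ?_, ?_⟩
    · have : (U ⟨p.src, p.ν⟩)⁻¹ * (x⁻¹ * GaugeField.plaqHol U p) * U ⟨p.src, p.ν⟩ =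
          ((U ⟨p.src, p.ν⟩)⁻¹ * (GaugeField.plaqHol U p)⁻¹) * (x * (GaugeField.plaqHol U p)⁻¹)⁻¹ *
            ((U ⟨p.src, p.ν⟩)⁻¹ * (GaugeField.plaqHol U p)⁻¹)⁻¹ := by group
      rw [this, GaugeGroup.dist1_conj, GaugeGroup.dist1_inv]
    · unfold GaugeField.plaqHol
      rw [update_self, update_of_ne h13, update_of_ne h23, update_of_ne h34.symm]
      group
  · -- edge 4 (inverted, last): `g = x⁻¹ · U(∂p)`
    refine ⟨x⁻¹ * GaugeField.plaqHol U p, ?_, ?_⟩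
    · have : x⁻¹ * GaugeField.plaqHol U p =
          (GaugeField.plaqHol U p)⁻¹ * (x * (GaugeField.plaqHol U p)⁻¹)⁻¹ * ((GaugeField.plaqHol U p)⁻¹)⁻¹ := by group
      rw [this, GaugeGroup.dist1_conj, GaugeGroup.dist1_inv]
    · unfold GaugeField.plaqHol
      rw [update_self, update_of_ne h14, update_of_ne h24, update_of_ne h34]
      group

end Edges

/-! ## §2 The plaquette variable of a central-edge plaquette is locally onto along the (0.4) fibre -/

section Main

variable {P : Params} {j : ℕ} [DecidableEq (PBond P j)]

set_option maxHeartbeats 400000 in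
/-- **CENTRAL-EDGE PLAQUETTES: `U(∂p)` IS OPEN ALONG THE (0.4) FIBRES AT SMALL FIELDS** ((T⊥)(iii) of UV3-NODE §67.7–§67.9 for the
private-reading plaquettes, `SU(2)`, chart-free).  Let `U` be `δ₁`-small (`((d+2)L)²δ₁∕4 < δ₂`) with loop variables at `c₀` within `α`
(`α < 1∕24`, `α < δ₂∕2`, `800ℓα < κ`, `κ = s′∕|I|` at `c₀`, `ν ≠ c₀.dir`); let `p` be a plaquette ONE OF WHOSE EDGES IS the private bond
`β(c₀)`, whose edges are private for NO OTHER coarse bond (`hfree`) and do not contain the centre leg `⟨emb c₀₋, ν⟩` (`hleg`).  Then for every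
`ε > 0` there is `η > 0` such that every `x ∈ SU(2)` with `dist1 (x·U(∂p)⁻¹) < η` is `U′(∂p)` for some `U′` in the fibre of `U`
(`Ū(U′) = Ū(U)`) that is `ε`-close to `U` bondwise.  Same three moves as ✓`loopHol_fibre_locally_onto`: the edge `β(c₀)` drives `U(∂p)`
(§1), the centre leg of `c₀` restores `Ū(c₀)` (✓`centreLeg_surjective`), the private bonds restore the other averages (✓`fibrewise_avgFun`).
(The two lattice side conditions hold for every plaquette containing a central crossing bond when `L ≥ 3`; they are displayed, not proved,
here.) [folklore] -/
theorem plaqHol_fibre_locally_onto (hj : j + 1 ≤ P.m + P.K) {δ₁ : ℝ} (hδ : 0 ≤ δ₁)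
    (hτ : ((((P.d + 2) * P.L : ℕ) : ℝ) ^ 2 / 4) * δ₁ < deltaSU (Fin 2))
    (U : GaugeField P j (Matrix.specialUnitaryGroup (Fin 2) ℂ)) (hU : PlaqSmall δ₁ U)
    (c₀ : PBond P (j + 1)) {ν : Fin P.d} (hν : ν ≠ c₀.dir) (p : Plaq P j)
    (hβ : centralBond c₀ = ⟨p.src, p.μ⟩ ∨ centralBond c₀ = ⟨p.src.shift p.μ, p.ν⟩ ∨ centralBond c₀ = ⟨p.src.shift p.ν, p.μ⟩ ∨
      centralBond c₀ = ⟨p.src, p.ν⟩)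
    (hfree : ∀ c2 : PBond P (j + 1), (centralBond c2 = ⟨p.src, p.μ⟩ ∨ centralBond c2 = ⟨p.src.shift p.μ, p.ν⟩ ∨
      centralBond c2 = ⟨p.src.shift p.ν, p.μ⟩ ∨ centralBond c2 = ⟨p.src, p.ν⟩) → c2 = c₀)
    (hleg : (⟨emb c₀.src, ν⟩ : PBond P j) ≠ ⟨p.src, p.μ⟩ ∧ (⟨emb c₀.src, ν⟩ : PBond P j) ≠ ⟨p.src.shift p.μ, p.ν⟩ ∧
      (⟨emb c₀.src, ν⟩ : PBond P j) ≠ ⟨p.src.shift p.ν, p.μ⟩ ∧ (⟨emb c₀.src, ν⟩ : PBond P j) ≠ ⟨p.src, p.ν⟩)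
    {α : ℝ} (hα : ∀ i', dist1 (loopHol U c₀ i') ≤ α) (κ : ℝ)
    (hκ : κ = ((Fintype.card (Idx P) : ℝ))⁻¹ *
      ((Finset.univ.filter fun i' : Idx P => (stairWord i'.2.1 (off i'.1)).head? = some (ν, true)).card : ℝ))
    (hA : α < 1 / 24) (hC : α < deltaSU (Fin 2) / 2) (hD : 800 * (((P.d + 2) * P.L : ℕ) : ℝ) * α < κ)
    {ε : ℝ} (hε : 0 < ε) :
    ∃ η : ℝ, 0 < η ∧ ∀ x : Matrix.specialUnitaryGroup (Fin 2) ℂ,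
      dist1 (x * (GaugeField.plaqHol U p)⁻¹) < η →
        ∃ U' : GaugeField P j (Matrix.specialUnitaryGroup (Fin 2) ℂ),
          (∀ b, ‖((U' b : Matrix.specialUnitaryGroup (Fin 2) ℂ) : Matrix (Fin 2) (Fin 2) ℂ) - (U b : Matrix (Fin 2) (Fin 2) ℂ)‖ < ε) ∧
          avgFun (expMeanLogSU (n := Fin 2)) U' = avgFun (expMeanLogSU (n := Fin 2)) U ∧ GaugeField.plaqHol U' p = x := by
  classical
  set ℓ : ℝ := (((P.d + 2) * P.L : ℕ) : ℝ) with hℓ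
  set e : PBond P j := ⟨emb c₀.src, ν⟩ with he
  have hℓ0 : 0 ≤ ℓ := Nat.cast_nonneg _
  have hκpos : 0 < κ := by rw [hκ]; exact kappa_pos (P := P) ν
  have hunit : ∀ g : Matrix.specialUnitaryGroup (Fin 2) ℂ, ((g : Matrix (Fin 2) (Fin 2) ℂ)) ∈ Matrix.unitaryGroup (Fin 2) ℂ :=
    fun g => (Matrix.mem_specialUnitaryGroup_iff.1 g.2).1
  have he_ne : ∀ c3 : PBond P (j + 1), e ≠ centralBond c3 := fun c3 => by rw [he]; exact centreLeg_ne_centralBond hj c₀ c3 ν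
  obtain ⟨𝒰, h𝒰o, hU𝒰, -, B, W, hBW, hfib⟩ := OneStepSubmersion.fibrewise_avgFun hj hδ hτ U hU Set.univ isOpen_univ
    (Set.mem_univ _) (fun c2 => {g | ‖(g : Matrix (Fin 2) (Fin 2) ℂ) - (U (centralBond c2) : Matrix (Fin 2) (Fin 2) ℂ)‖ < ε})
    (fun c2 => ⟨isOpen_lt (continuous_subtype_val.sub continuous_const).norm continuous_const, by simpa using hε⟩)
  obtain ⟨ε₀, hε₀, hbox⟩ := exists_box_subset_of_mem_nhds (h𝒰o.mem_nhds hU𝒰)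
  set Cκ : ℝ := 1 + 2 / κ with hCκ
  have h2κ : 0 ≤ 2 / κ := div_nonneg (by norm_num) hκpos.le
  have hCκ1 : 1 ≤ Cκ := by rw [hCκ]; linarith
  have hP1 : 0 ≤ 800 * ℓ * (ℓ + Cκ) := by positivity
  set M : ℝ := Cκ + 48 * ℓ + (2 * ℓ + Cκ) + 800 * ℓ * (ℓ + Cκ) + 1 with hM
  have hM1 : 1 ≤ M := by rw [hM]; linarith
  set σ : ℝ := min (min (min (1 / 24 - α) (deltaSU (Fin 2) / 2 - α)) (min (κ - 800 * ℓ * α) 1)) (min ε ε₀) with hσ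
  have hσ0 : 0 < σ := by
    rw [hσ]; exact lt_min (lt_min (lt_min (by linarith) (by linarith)) (lt_min (by linarith) one_pos)) (lt_min hε hε₀)
  have hσ1 : σ ≤ 1 / 24 - α := by rw [hσ]; exact (min_le_left _ _).trans ((min_le_left _ _).trans (min_le_left _ _))
  have hσ2 : σ ≤ deltaSU (Fin 2) / 2 - α := by rw [hσ]; exact (min_le_left _ _).trans ((min_le_left _ _).trans (min_le_right _ _))
  have hσ3 : σ ≤ κ - 800 * ℓ * α := by rw [hσ]; exact (min_le_left _ _).trans ((min_le_right _ _).trans (min_le_left _ _))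
  have hσ5 : σ ≤ ε := by rw [hσ]; exact (min_le_right _ _).trans (min_le_left _ _)
  have hσ6 : σ ≤ ε₀ := by rw [hσ]; exact (min_le_right _ _).trans (min_le_right _ _)
  set s : ℝ := σ / (2 * M) with hs
  have hs0 : 0 < s := div_pos hσ0 (by linarith)
  have hMs : M * s = σ / 2 := by rw [hs]; field_simp
  have hsσ : ∀ a : ℝ, a ≤ M → a * s < σ := fun a haM => by
    calc a * s ≤ M * s := mul_le_mul_of_nonneg_right haM hs0.le
      _ = σ / 2 := hMs
      _ < σ := by linarith
  have hCs : (α + s) + 2 * s / κ = α + Cκ * s := by rw [hCκ]; ring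
  have hT1 : (α + s) + 2 * s / κ ≤ 1 / 24 := by
    have := hsσ Cκ (by rw [hM]; linarith); rw [hCs]; linarith
  have hT2 : 48 * (ℓ * s) ≤ 1 := by
    have := hsσ (48 * ℓ) (by rw [hM]; linarith)
    have e2 : 48 * (ℓ * s) = (48 * ℓ) * s := by ring
    have hσ4 : σ ≤ 1 := by rw [hσ]; exact (min_le_left _ _).trans ((min_le_right _ _).trans (min_le_right _ _))
    linarith
  have hT3 : 2 * (ℓ * s) + ((α + s) + 2 * s / κ) < deltaSU (Fin 2) / 2 := by
    have := hsσ (2 * ℓ + Cκ) (by rw [hM]; linarith)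
    have e3 : 2 * (ℓ * s) + ((α + s) + 2 * s / κ) = α + (2 * ℓ + Cκ) * s := by rw [hCκ]; ring
    linarith
  have hT4 : 800 * ℓ * (ℓ * s + ((α + s) + 2 * s / κ)) ≤ κ := by
    have := hsσ (800 * ℓ * (ℓ + Cκ)) (by rw [hM]; linarith)
    have e4 : 800 * ℓ * (ℓ * s + ((α + s) + 2 * s / κ)) = 800 * ℓ * α + (800 * ℓ * (ℓ + Cκ)) * s := by rw [hCκ]; ring
    linarith
  have hCsσ : Cκ * s < σ := hsσ Cκ (by rw [hM]; linarith)
  have hs_le : s ≤ Cκ * s := le_mul_of_one_le_left hs0.le hCκ1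
  have h2sκ_le : 2 * s / κ ≤ Cκ * s := by
    have : Cκ * s = s + 2 * s / κ := by rw [hCκ]; ring
    linarith
  have hs_lt_ε : s < ε := by linarith
  have hs_lt_ε₀ : s < ε₀ := by linarith
  have h2sκ_ε : 2 * s / κ < ε := by linarith
  have h2sκ_ε₀ : 2 * s / κ < ε₀ := by linarith
  -- continuity of `Ū(·)(c₀)` at `U`
  have hloopsU : ∀ i', dist1 (loopHol U c₀ i') < deltaSU (Fin 2) / 2 := fun i' => (hα i').trans_lt hC
  have hcontU := continuousAt_avgFun_apply (n := Fin 2) U c₀ hloopsU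
  have hpre : {U' : GaugeField P j (Matrix.specialUnitaryGroup (Fin 2) ℂ) |
      ‖((avgFun (expMeanLogSU (n := Fin 2)) U' c₀ : Matrix.specialUnitaryGroup (Fin 2) ℂ) : Matrix (Fin 2) (Fin 2) ℂ) -
        ((avgFun (expMeanLogSU (n := Fin 2)) U c₀ : Matrix.specialUnitaryGroup (Fin 2) ℂ) : Matrix (Fin 2) (Fin 2) ℂ)‖ < s} ∈ 𝓝 U := by
    have hopen : IsOpen {K : Matrix.specialUnitaryGroup (Fin 2) ℂ | ‖(K : Matrix (Fin 2) (Fin 2) ℂ) -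
        ((avgFun (expMeanLogSU (n := Fin 2)) U c₀ : Matrix.specialUnitaryGroup (Fin 2) ℂ) : Matrix (Fin 2) (Fin 2) ℂ)‖ < s} :=
      isOpen_lt (continuous_subtype_val.sub continuous_const).norm continuous_const
    exact hcontU.preimage_mem_nhds (hopen.mem_nhds (by simpa using hs0))
  obtain ⟨η₁, hη₁, hbox₁⟩ := exists_box_subset_of_mem_nhds hpre
  refine ⟨min s η₁, lt_min hs0 hη₁, fun x hx => ?_⟩
  -- STEP 1: the edge driver on `β(c₀) ∈ ∂p`
  obtain ⟨gβ, hgβ1, hgβx⟩ := exists_edge_driver hj U p hβ x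
  have hgβs : dist1 gβ < s := by rw [hgβ1]; exact hx.trans_le (min_le_left _ _)
  have hgβn : ‖((gβ : Matrix.specialUnitaryGroup (Fin 2) ℂ) : Matrix (Fin 2) (Fin 2) ℂ) - 1‖ < min s η₁ := by
    rw [← FederbushMean.dist1_SU_eq, hgβ1]; exact hx
  obtain ⟨U₁, hU₁⟩ : ∃ U₁ : GaugeField P j (Matrix.specialUnitaryGroup (Fin 2) ℂ),
      U₁ = update U (centralBond c₀) (gβ * U (centralBond c₀)) := ⟨_, rfl⟩
  have hU₁b : ∀ b, ‖((U₁ b : Matrix.specialUnitaryGroup (Fin 2) ℂ) : Matrix (Fin 2) (Fin 2) ℂ) - (U b : Matrix (Fin 2) (Fin 2) ℂ)‖ ≤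
      ‖((gβ : Matrix.specialUnitaryGroup (Fin 2) ℂ) : Matrix (Fin 2) (Fin 2) ℂ) - 1‖ := by
    intro b
    by_cases hb : b = centralBond c₀
    · rw [hb, hU₁, update_self]; exact norm_mul_sub_self_le _ _
    · rw [hU₁, update_of_ne hb, sub_self, norm_zero]; exact norm_nonneg _
  have hα₁ : ∀ i', dist1 (loopHol U₁ c₀ i') ≤ α + s := fun i' => by
    rw [hU₁]
    have := dist1_loopHol_update_centralBond_le hj U c₀ gβ i'
    linarith [hα i', hgβs.le]
  have hK₁ : ‖((avgFun (expMeanLogSU (n := Fin 2)) U₁ c₀ : Matrix.specialUnitaryGroup (Fin 2) ℂ) : Matrix (Fin 2) (Fin 2) ℂ) -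
      ((avgFun (expMeanLogSU (n := Fin 2)) U c₀ : Matrix.specialUnitaryGroup (Fin 2) ℂ) : Matrix (Fin 2) (Fin 2) ℂ)‖ < s :=
    hbox₁ U₁ fun b => (hU₁b b).trans_lt (hgβn.trans_le (min_le_right _ _))
  -- STEP 2: the centre leg of `c₀` restores `Ū(c₀)`
  obtain ⟨T, hT⟩ : ∃ T : Matrix.specialUnitaryGroup (Fin 2) ℂ, T = avgFun (expMeanLogSU (n := Fin 2)) U c₀ := ⟨_, rfl⟩
  have hTres : ‖(T : Matrix (Fin 2) (Fin 2) ℂ) *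
      star ((avgFun (expMeanLogSU (n := Fin 2)) U₁ c₀ : Matrix.specialUnitaryGroup (Fin 2) ℂ) : Matrix (Fin 2) (Fin 2) ℂ) - 1‖ ≤ s := by
    set K₁ : Matrix (Fin 2) (Fin 2) ℂ := ((avgFun (expMeanLogSU (n := Fin 2)) U₁ c₀ : Matrix.specialUnitaryGroup (Fin 2) ℂ) :
      Matrix (Fin 2) (Fin 2) ℂ) with hK₁def
    have hKu : K₁ ∈ Matrix.unitaryGroup (Fin 2) ℂ := hunit _
    have hid : (T : Matrix (Fin 2) (Fin 2) ℂ) * star K₁ - 1 = ((T : Matrix (Fin 2) (Fin 2) ℂ) - K₁) * star K₁ := by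
      rw [sub_mul, Unitary.mul_star_self_of_mem hKu]
    rw [hid]
    calc _ ≤ ‖(T : Matrix (Fin 2) (Fin 2) ℂ) - K₁‖ * ‖star K₁‖ := norm_mul_le _ _
      _ = ‖K₁ - (T : Matrix (Fin 2) (Fin 2) ℂ)‖ := by rw [norm_star, CStarRing.norm_of_mem_unitary hKu, mul_one, norm_sub_rev]
      _ ≤ s := by rw [hT, hK₁def]; exact hK₁.le
  obtain ⟨g, hg, hK₂⟩ := centreLeg_surjective hj U₁ c₀ hν κ hκ hα₁ hT1 hT2 hT3 hT4 T hTres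
  obtain ⟨U₂, hU₂⟩ : ∃ U₂ : GaugeField P j (Matrix.specialUnitaryGroup (Fin 2) ℂ), U₂ = update U₁ e (g * U₁ e) := ⟨_, rfl⟩
  have hU₁e : U₁ e = U e := by rw [hU₁, update_of_ne (he_ne c₀)]
  have hU₂b : ∀ b, ‖((U₂ b : Matrix.specialUnitaryGroup (Fin 2) ℂ) : Matrix (Fin 2) (Fin 2) ℂ) - (U b : Matrix (Fin 2) (Fin 2) ℂ)‖ <
      min ε ε₀ := by
    intro b
    by_cases hb : b = e
    · rw [hb, hU₂, update_self, hU₁e]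
      exact (norm_mul_sub_self_le _ _).trans_lt (hg.trans_lt (lt_min h2sκ_ε h2sκ_ε₀))
    · rw [hU₂, update_of_ne hb]
      exact (hU₁b b).trans_lt ((hgβn.trans_le (min_le_left _ _)).trans (lt_min hs_lt_ε hs_lt_ε₀))
  have hU₂𝒰 : U₂ ∈ 𝒰 := hbox U₂ fun b => (hU₂b b).trans_le (min_le_right _ _)
  have hK₂' : avgFun (expMeanLogSU (n := Fin 2)) U₂ c₀ = avgFun (expMeanLogSU (n := Fin 2)) U c₀ := by
    rw [hU₂, he, hK₂, hT]
  -- STEP 3: the private bonds restore every other `Ū(c″)`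
  have hsol : ∀ c2 : PBond P (j + 1), ∃ g2 : Matrix.specialUnitaryGroup (Fin 2) ℂ, g2 ∈ B c2 ∧
      avgFun (expMeanLogSU (n := Fin 2)) (update U₂ (centralBond c2) g2) c2 = avgFun (expMeanLogSU (n := Fin 2)) U c2 := by
    intro c2
    obtain ⟨g2, hg2B, hg2eq⟩ := (hfib U₂ hU₂𝒰 c2).1 (hBW c2).2.2.2
    exact ⟨g2, hg2B, hg2eq⟩
  choose gsol hgsolB hgsol using hsol
  obtain ⟨val, hval⟩ : ∃ val : PBond P (j + 1) → Matrix.specialUnitaryGroup (Fin 2) ℂ,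
      val = fun c2 => if c2 = c₀ then U₂ (centralBond c₀) else gsol c2 := ⟨_, rfl⟩
  obtain ⟨U₃, hU₃⟩ : ∃ U₃ : GaugeField P j (Matrix.specialUnitaryGroup (Fin 2) ℂ), U₃ = Function.extend centralBond val U₂ := ⟨_, rfl⟩
  have hβinj := centralBond_injective (P := P) (j := j) hj
  have hU₃β : ∀ c2, U₃ (centralBond c2) = val c2 := fun c2 => by rw [hU₃]; exact hβinj.extend_apply _ _ _
  have hU₃off : ∀ b, (¬ ∃ c2, centralBond c2 = b) → U₃ b = U₂ b := fun b hb => by rw [hU₃]; exact Function.extend_apply' _ _ _ hb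
  have hagree_c : ∀ b : PBond P j, (∀ c3 : PBond P (j + 1), b = centralBond c3 → c3 = c₀) → U₃ b = U₂ b := by
    intro b hb
    by_cases hex : ∃ c2, centralBond c2 = b
    · obtain ⟨c2, rfl⟩ := hex
      have := hb c2 rfl; subst this
      rw [hU₃β, hval]; simp
    · exact hU₃off b hex
  have havg : avgFun (expMeanLogSU (n := Fin 2)) U₃ = avgFun (expMeanLogSU (n := Fin 2)) U := by
    funext c2
    by_cases hc2 : c2 = c₀
    · subst hc2
      rw [avgFun_congr_off_private hj _ U₃ U₂ c2 hagree_c, hK₂']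
    · rw [← hgsol c2]
      refine avgFun_congr_off_private hj _ U₃ _ c2 fun b hb => ?_
      by_cases hex : ∃ c3, centralBond c3 = b
      · obtain ⟨c3, rfl⟩ := hex
        have := hb c3 rfl; subst this
        rw [hU₃β, hval, update_self]; simp [hc2]
      · rw [hU₃off b hex, update_of_ne]
        exact fun h => hex ⟨c2, h.symm⟩
  -- the plaquette: `U₃ = U₂` on `∂p` (only `β(c₀)` is private there), `U₂ = U₁` on `∂p` (the centre leg is not an edge)
  have hedge : ∀ b : PBond P j, (b = ⟨p.src, p.μ⟩ ∨ b = ⟨p.src.shift p.μ, p.ν⟩ ∨ b = ⟨p.src.shift p.ν, p.μ⟩ ∨ b = ⟨p.src, p.ν⟩) →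
      U₃ b = U₁ b := by
    intro b hb
    have h32 : U₃ b = U₂ b := hagree_c b fun c3 hc3 => hfree c3 (by rw [← hc3]; exact hb)
    have hbe : b ≠ e := by
      rintro rfl
      rcases hb with h | h | h | h
      · exact hleg.1 (he ▸ h)
      · exact hleg.2.1 (he ▸ h)
      · exact hleg.2.2.1 (he ▸ h)
      · exact hleg.2.2.2 (he ▸ h)
    rw [h32, hU₂, update_of_ne hbe]
  have hplaq : GaugeField.plaqHol U₃ p = x := by
    rw [plaqHol_congr_edges p (hedge _ (Or.inl rfl)) (hedge _ (Or.inr (Or.inl rfl))) (hedge _ (Or.inr (Or.inr (Or.inl rfl))))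
      (hedge _ (Or.inr (Or.inr (Or.inr rfl)))), hU₁]
    exact hgβx
  have hboxε : ∀ b, ‖((U₃ b : Matrix.specialUnitaryGroup (Fin 2) ℂ) : Matrix (Fin 2) (Fin 2) ℂ) - (U b : Matrix (Fin 2) (Fin 2) ℂ)‖ < ε := by
    intro b
    by_cases hex : ∃ c2, centralBond c2 = b
    · obtain ⟨c2, rfl⟩ := hex
      rw [hU₃β]
      by_cases hc2 : c2 = c₀
      · subst hc2
        have hv : val c2 = U₂ (centralBond c2) := by simp [hval]
        rw [hv]; exact (hU₂b _).trans_le (min_le_left _ _)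
      · have hv : val c2 = gsol c2 := by simp [hval, hc2]
        rw [hv]
        have := (hBW c2).2.1 (hgsolB c2)
        simpa using this
    · rw [hU₃off b hex]; exact (hU₂b b).trans_le (min_le_left _ _)
  exact ⟨U₃, hboxε, havg, hplaq⟩

end Main


end Summit.QuantumFields.YangMills.Theorems.FluctuationComparisonRegPrIntLS1aFibreOpenPlaquette

end
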